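import Literature.NumberTheory.DiophantineGeometry.ApproximationBoundRatPadicUnitsProofs
import HarnessLib

/-!
# The `p`-adic approximation bound over `ℚ` from a core in SHAPE form — Case A of
# Evertse–Győry §4.4.2 at `α = 1` through a bound for dependent `p`-adic units

Topic `NumberTheory/DiophantineGeometry`; namespace `Literature.NumberTheory.DiophantineGeometry.Dioph`.
Proofs only: no definition, no named fact. Second of three companion files (see
`ApproximationBoundRatPadicUnitsProofs.lean`). `caseA_padic_bound`: for the height-minimal system
`ξ'` with small exponents `|b'ᵢ| ≤ B₀ = m^{2m} h(x)/log 2` (`x = ζ' ∏ ξ'ᵢ^{b'ᵢ} ∉ {±1}` a `p`-adic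
unit) in Case A (`2e·9^{m+1}·Θ' ≤ B₀`), passing to `p`-adic units, dropping those equal to `±1`
and squaring, a `p`-adic linear-forms bound in shape form for DEPENDENT rational `p`-adic units
(hypothesis `hdepP`, constant `C ≥ 1`, log slot `log B + log p + ∑ log(3h(αₖ)) + 2n`) yields
`ord_p(1 − x)·log p ≤ (32C/log 2)^m · (p/log p) · log max(e, p·h(x)) · Θ'`.

## References

* [EvertseGyory2015] J.-H. Evertse, K. Győry, *Unit Equations in Diophantine Number Theory*,
  CUP 2015 — proof of Thm 4.2.1, §4.4.2 (pp. 80–81).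
-/

noncomputable section

open Finset Real Height

namespace Literature.NumberTheory.DiophantineGeometry.Dioph

/-! ### Two elementary lemmas -/

/-- `∏_{i ∈ s} f i ≤ ∏_i g i` when `0 ≤ f ≤ g` on `s` and `1 ≤ g` off `s`. [folklore] -/
private theorem prod_le_prod_univ_of_one_le {ι : Type} [Fintype ι] [DecidableEq ι] (s : Finset ι)
    (f g : ι → ℝ) (h0 : ∀ i ∈ s, 0 ≤ f i) (hfg : ∀ i ∈ s, f i ≤ g i) (hg1 : ∀ i, i ∉ s → 1 ≤ g i) :
    ∏ i ∈ s, f i ≤ ∏ i, g i := by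
  have h1 : ∏ i ∈ s, f i ≤ ∏ i ∈ s, g i := Finset.prod_le_prod h0 hfg
  have h2 : 1 ≤ ∏ i ∈ sᶜ, g i :=
    Finset.prod_induction g (fun x => 1 ≤ x) (fun _ _ ha hb => one_le_mul_of_one_le_of_one_le ha hb)
      le_rfl fun i hi => hg1 i (Finset.mem_compl.mp hi)
  have h3 : 0 ≤ ∏ i ∈ s, g i := Finset.prod_nonneg fun i hi => (h0 i hi).trans (hfg i hi)
  rw [← Finset.prod_mul_prod_compl s g]
  nlinarith

/-- `ord_p(1 − x) ≤ ord_p(x² − 1)` for a `p`-adic unit `x ∉ {0, 1, −1}`. [folklore] -/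
private theorem padicValRat_one_sub_le_sq_sub_one {p : ℕ} [Fact p.Prime] {x : ℚ} (hx : x ≠ 0)
    (hv : padicValRat p x = 0) (hx1 : x ≠ 1) (hx2 : x ≠ -1) :
    padicValRat p (1 - x) ≤ padicValRat p (x ^ 2 - 1) := by
  have hsq : x ^ (2 : ℤ) ≠ 1 := by
    intro h
    rcases Literature.Barriers.ABC.rat_eq_sign_of_zpow_eq_one (by norm_num) h with h1 | h1
    · exact hx1 h1
    · exact hx2 h1
  have h := Literature.Barriers.ABC.padicValRat_sub_one_le_zpow_sub_one hx hv (n := 2) (by norm_num)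
    hsq
  rw [← neg_sub, padicValRat.neg]
  have h2 : x ^ (2 : ℤ) = x ^ 2 := by norm_cast
  rwa [h2] at h


/-! ### Case A through the dependent core -/

/-- **Case A of Evertse–Győry §4.4.2 at `α = 1`, through a dependent `p`-adic core in shape form.**
For the height-minimal system `ξ'` with small exponents (`|b'ᵢ| ≤ B₀ = m^{2m} h(x)/log 2`,
`x = ζ' ∏ ξ'ᵢ^{b'ᵢ} ∉ {1, −1}` a `p`-adic unit) in Case A (`2e·9^{m+1}·Θ' ≤ B₀`): passing to
`p`-adic units, dropping the units equal to `±1` and squaring, the hypothesis `hdepP` (the shape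
bound for dependent `p`-adic units at the prime `p`, constant `C ≥ 1`) gives
`ord_p(1 − x)·log p ≤ (32C/log 2)^m · (p/log p) · log max(e, p·h(x)) · Θ'`.
[cite: EvertseGyory2015, §4.4.2 (pp. 80–81)] -/
theorem caseA_padic_bound {p : ℕ} [hp : Fact p.Prime] {C : ℝ} (hC : 1 ≤ C)
    (hdepP : ∀ (κ : Type) [Fintype κ] [DecidableEq κ] (α : κ → ℚ) (b : κ → ℤ) (B : ℝ),
      (∀ k, α k ≠ 0) → (∀ k, padicValRat p (α k) = 0) → (∀ k, α k ≠ 1) → (∀ k, α k ≠ -1) →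
      (p = 2 → ∀ k, 3 ≤ padicValRat 2 (α k - 1)) →
      (∀ k, (|b k| : ℝ) ≤ B) → 3 ≤ B → ∏ k, α k ^ b k ≠ 1 →
      (padicValRat p (∏ k, α k ^ b k - 1) : ℝ) * Real.log p ≤
        C ^ Fintype.card κ * (p / Real.log p) * (∏ k, logHeight₁ (α k)) *
          (Real.log B + Real.log p + ∑ k, Real.log (3 * logHeight₁ (α k)) +
            2 * Fintype.card κ))
    {ι : Type} [Fintype ι] [DecidableEq ι] {n : ℕ} (hcard : Fintype.card ι = n + 1)
    (ξ : ι → ℚ) (hξ : ∀ i, ξ i ≠ 0 ∧ ξ i ≠ 1 ∧ ξ i ≠ -1) (ζ : ℚ) (hζ : ζ = 1 ∨ ζ = -1)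
    (b : ι → ℤ) {x : ℚ} (hx : x = ζ * ∏ i, ξ i ^ b i) (hx1 : x ≠ 1) (hx2 : x ≠ -1)
    (hvx : padicValRat p x = 0) {B₀ : ℝ}
    (hB₀ : B₀ = (Fintype.card ι : ℝ) ^ (2 * Fintype.card ι) * logHeight₁ x / Real.log 2)
    (hb : ∀ i, (|b i| : ℝ) ≤ B₀)
    (hcase : 2 * Real.exp 1 * 9 ^ (Fintype.card ι + 1) * (∏ i, logHeight₁ (ξ i)) ≤ B₀) :
    (padicValRat p (1 - x) : ℝ) * Real.log p ≤
      (32 * C / Real.log 2) ^ Fintype.card ι * (p / Real.log p) *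
        Real.log (max (Real.exp 1) (p * logHeight₁ x)) * ∏ i, logHeight₁ (ξ i) := by
  set m := Fintype.card ι with hm
  set Θ' := ∏ i, logHeight₁ (ξ i) with hΘ'
  set L := Real.log (max (Real.exp 1) (p * logHeight₁ x)) with hL
  have hm1 : 1 ≤ m := by omega
  have hl2 : 0 < Real.log 2 := Real.log_pos one_lt_two
  have hl2' : Real.log 2 ≤ 1 := by linarith [Real.log_two_lt_d9]
  have hp1 : (1 : ℝ) ≤ p := by exact_mod_cast hp.out.one_lt.le
  have hlogp : 0 ≤ Real.log p := Real.log_nonneg hp1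
  have hpdiv : 0 ≤ (p : ℝ) / Real.log p := div_nonneg (by linarith) hlogp
  have hhξ : ∀ i, Real.log 2 ≤ logHeight₁ (ξ i) := fun i =>
    log_two_le_logHeight₁ (hξ i).1 (hξ i).2.1 (hξ i).2.2
  -- `x ≠ 0`, `h(x) > 0`
  have hζ0 : ζ ≠ 0 := by rcases hζ with rfl | rfl <;> norm_num
  have hP0 : ∏ i, ξ i ^ b i ≠ 0 := Finset.prod_ne_zero_iff.mpr fun i _ => zpow_ne_zero _ (hξ i).1
  have hx0 : x ≠ 0 := by rw [hx]; exact mul_ne_zero hζ0 hP0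
  have hhx : 0 < logHeight₁ x := lt_of_lt_of_le hl2 (log_two_le_logHeight₁ hx0 hx1 hx2)
  -- `Θ' ≥ (log 2)^m`, `B₀ ≥ 3`
  have hΘlow : Real.log 2 ^ m ≤ Θ' := by
    have : ∏ _i : ι, Real.log 2 = Real.log 2 ^ m := by rw [Finset.prod_const, Finset.card_univ]
    rw [← this]
    exact Finset.prod_le_prod (fun i _ => hl2.le) fun i _ => hhξ i
  have hΘ'0 : 0 < Θ' := lt_of_lt_of_le (pow_pos hl2 m) hΘlow
  have hB3 : 3 ≤ B₀ := by
    have h1 : (1 / 2 : ℝ) ^ m ≤ Θ' := le_trans (pow_le_pow_left₀ (by norm_num)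
      (by linarith [Real.log_two_gt_d9]) m) hΘlow
    have h2 : (3 : ℝ) ≤ 2 * Real.exp 1 * 9 ^ (m + 1) * (1 / 2) ^ m := by
      have he : (1 : ℝ) ≤ Real.exp 1 := Real.one_le_exp zero_le_one
      have h3 : (9 : ℝ) ^ (m + 1) * (1 / 2) ^ m = 9 * (9 * (1 / 2)) ^ m := by
        rw [pow_succ, mul_pow]; ring
      have h4 : (1 : ℝ) ≤ (9 * (1 / 2)) ^ m := one_le_pow₀ (by norm_num)
      have h5 : (9 : ℝ) ≤ 9 ^ (m + 1) * (1 / 2) ^ m := by rw [h3]; nlinarith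
      have h6 : 2 * Real.exp 1 * 9 ^ (m + 1) * (1 / 2 : ℝ) ^ m =
          (2 * Real.exp 1) * (9 ^ (m + 1) * (1 / 2) ^ m) := by ring
      rw [h6]
      nlinarith
    have h5 : 2 * Real.exp 1 * 9 ^ (m + 1) * (1 / 2 : ℝ) ^ m ≤ 2 * Real.exp 1 * 9 ^ (m + 1) * Θ' :=
      mul_le_mul_of_nonneg_left h1 (by positivity)
    linarith
  have hB0 : 0 < B₀ := by linarith
  -- the product `P = ∏ ξᵢ^{bᵢ} = ζ x` is a `p`-adic unit
  have hPeq : ∏ i, ξ i ^ b i = ζ * x := by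
    rw [hx, ← mul_assoc]
    rcases hζ with rfl | rfl <;> norm_num
  have hvζ : padicValRat p ζ = 0 := by
    rcases hζ with rfl | rfl
    · exact padicValRat.one
    · rw [padicValRat.neg, padicValRat.one]
  have hvP : padicValRat p (∏ i, ξ i ^ b i) = 0 := by
    rw [hPeq, padicValRat.mul hζ0 hx0, hvζ, hvx, add_zero]
  -- passage to units, then squaring on the subtype
  obtain ⟨θ, hθ0, hθv, hθh, hθprod⟩ := exists_padicUnit_system ξ (fun i => (hξ i).1) b hvP
  obtain ⟨hκ, hprodκ⟩ := sq_system_on_subtype (p := p) θ hθ0 hθv b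
  have hsq : (∏ i, θ i ^ b i) ^ 2 = x ^ 2 := by
    rw [hθprod, hPeq, mul_pow]
    rcases hζ with rfl | rfl <;> norm_num
  have hx2ne : x ^ 2 ≠ 1 := by
    intro h
    have h' : x ^ (2 : ℤ) = 1 := by exact_mod_cast h
    rcases Literature.Barriers.ABC.rat_eq_sign_of_zpow_eq_one (by norm_num) h' with h1 | h1
    · exact hx1 h1
    · exact hx2 h1
  have hne1 : ∏ k : {i // θ i ^ 2 ≠ 1}, (θ k.val ^ 2) ^ b k.val ≠ 1 := by
    rw [hprodκ, hsq]; exact hx2ne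
  -- the core bound
  have hmain := hdepP {i // θ i ^ 2 ≠ 1} (fun k => θ k.val ^ 2) (fun k => b k.val) B₀
    (fun k => (hκ k).1) (fun k => (hκ k).2.1) (fun k => (hκ k).2.2.1) (fun k => (hκ k).2.2.2.1)
    (fun h2 k => (hκ k).2.2.2.2.1 h2) (fun k => hb k.val) hB3 hne1
  rw [hprodκ, hsq] at hmain
  -- valuation comparison
  have hvle : padicValRat p (1 - x) ≤ padicValRat p (x ^ 2 - 1) :=
    padicValRat_one_sub_le_sq_sub_one hx0 hvx hx1 hx2
  have hvle' : (padicValRat p (1 - x) : ℝ) * Real.log p ≤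
      (padicValRat p (x ^ 2 - 1) : ℝ) * Real.log p :=
    mul_le_mul_of_nonneg_right (by exact_mod_cast hvle) hlogp
  -- the weights: `C^{|κ|} ∏_κ h(θ²) ≤ (2C/log 2)^m Θ'`
  set s : Finset ι := univ.filter (fun i => θ i ^ 2 ≠ 1) with hs
  have hmem : ∀ i, i ∈ s ↔ θ i ^ 2 ≠ 1 := fun i => by simp [hs]
  have hcardκ : (Fintype.card {i // θ i ^ 2 ≠ 1} : ℝ) ≤ m := by
    exact_mod_cast Fintype.card_subtype_le _
  have hsq2 : ∀ i, logHeight₁ (θ i ^ 2) = 2 * logHeight₁ (θ i) := fun i => by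
    rw [logHeight₁_pow]; push_cast; ring
  obtain ⟨n', hn'⟩ : ∃ n', Fintype.card ι = n' + 1 := ⟨n, hcard⟩
  have hcase' : 2 * Real.exp 1 * 9 ^ (n' + 1 + 1) * (∏ j, logHeight₁ (ξ j)) ≤ B₀ := by
    rw [← hn']; exact hcase
  have h2h : ∀ i, 2 * logHeight₁ (ξ i) ≤ B₀ := two_mul_logHeight₁_le_of_caseA hn' ξ hξ hcase'
  have hW : C ^ Fintype.card {i // θ i ^ 2 ≠ 1} *
      ∏ k : {i // θ i ^ 2 ≠ 1}, logHeight₁ (θ k.val ^ 2) ≤ (2 * C / Real.log 2) ^ m * Θ' := by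
    have h1 : C ^ Fintype.card {i // θ i ^ 2 ≠ 1} *
        ∏ k : {i // θ i ^ 2 ≠ 1}, logHeight₁ (θ k.val ^ 2) =
        ∏ k : {i // θ i ^ 2 ≠ 1}, (C * logHeight₁ (θ k.val ^ 2)) := by
      rw [Finset.prod_mul_distrib, Finset.prod_const, Finset.card_univ]
    have h2 : ∏ k : {i // θ i ^ 2 ≠ 1}, (C * logHeight₁ (θ k.val ^ 2)) =
        ∏ i ∈ s, (C * logHeight₁ (θ i ^ 2)) :=
      (Finset.prod_subtype s hmem (fun i => C * logHeight₁ (θ i ^ 2))).symm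
    have h3 : (2 * C / Real.log 2) ^ m * Θ' = ∏ i, (2 * C / Real.log 2 * logHeight₁ (ξ i)) := by
      rw [Finset.prod_mul_distrib, Finset.prod_const, Finset.card_univ]
    rw [h1, h2, h3]
    apply prod_le_prod_univ_of_one_le s
    · intro i _; exact mul_nonneg (by linarith) (zero_le_logHeight₁ _)
    · intro i _
      rw [hsq2 i]
      have hCle : 2 * C ≤ 2 * C / Real.log 2 := by
        rw [le_div_iff₀ hl2]; nlinarith
      have hh0 : 0 ≤ logHeight₁ (ξ i) := zero_le_logHeight₁ _
      calc C * (2 * logHeight₁ (θ i)) = 2 * C * logHeight₁ (θ i) := by ring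
        _ ≤ 2 * C * logHeight₁ (ξ i) := mul_le_mul_of_nonneg_left (hθh i) (by linarith)
        _ ≤ 2 * C / Real.log 2 * logHeight₁ (ξ i) := mul_le_mul_of_nonneg_right hCle hh0
    · intro i _
      calc (1 : ℝ) ≤ 2 * C := by linarith
        _ = 2 * C / Real.log 2 * Real.log 2 := by field_simp
        _ ≤ 2 * C / Real.log 2 * logHeight₁ (ξ i) :=
            mul_le_mul_of_nonneg_left (hhξ i) (by positivity)
  -- the logarithm: `≤ 16^m L`
  have hS : Real.log B₀ + Real.log p +
      ∑ k : {i // θ i ^ 2 ≠ 1}, Real.log (3 * logHeight₁ (θ k.val ^ 2)) +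
        2 * (Fintype.card {i // θ i ^ 2 ≠ 1} : ℝ) ≤ 16 ^ m * L := by
    have h1 : ∑ k : {i // θ i ^ 2 ≠ 1}, Real.log (3 * logHeight₁ (θ k.val ^ 2)) =
        ∑ i ∈ s, Real.log (3 * logHeight₁ (θ i ^ 2)) :=
      (Finset.sum_subtype s hmem (fun i => Real.log (3 * logHeight₁ (θ i ^ 2)))).symm
    have hlog3B : 0 ≤ Real.log (3 * B₀) := Real.log_nonneg (by linarith)
    have h2 : ∑ i ∈ s, Real.log (3 * logHeight₁ (θ i ^ 2)) ≤ ∑ i ∈ s, Real.log (3 * B₀) := by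
      apply Finset.sum_le_sum
      intro i hi
      have hne : θ i ^ 2 ≠ 1 := (hmem i).mp hi
      have hne' : θ i ^ 2 ≠ -1 := by
        intro h; have := sq_nonneg (θ i); rw [h] at this; norm_num at this
      have hpos : 0 < 3 * logHeight₁ (θ i ^ 2) :=
        mul_pos (by norm_num) (lt_of_lt_of_le hl2
          (log_two_le_logHeight₁ (pow_ne_zero 2 (hθ0 i)) hne hne'))
      apply Real.log_le_log hpos
      rw [hsq2 i]
      linarith [hθh i, h2h i]
    have h3 : ∑ i ∈ s, Real.log (3 * B₀) ≤ ∑ _i : ι, Real.log (3 * B₀) :=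
      Finset.sum_le_sum_of_subset_of_nonneg (Finset.subset_univ s) fun _ _ _ => hlog3B
    have h23 := h2.trans h3
    rw [Finset.sum_const, Finset.card_univ, nsmul_eq_mul] at h23
    have h4 := caseA_logslot_le m hm1 hhx hp1 hB₀ hB3
    have hlogB0 : 0 ≤ Real.log B₀ := Real.log_nonneg (by linarith)
    have hm0 : (0 : ℝ) ≤ m := by positivity
    rw [h1]
    nlinarith
  -- nonnegativity of the two factors and assembly
  have hW0 : 0 ≤ C ^ Fintype.card {i // θ i ^ 2 ≠ 1} *
      ∏ k : {i // θ i ^ 2 ≠ 1}, logHeight₁ (θ k.val ^ 2) :=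
    mul_nonneg (pow_nonneg (by linarith) _) (Finset.prod_nonneg fun k _ => zero_le_logHeight₁ _)
  have hS0 : 0 ≤ Real.log B₀ + Real.log p +
      ∑ k : {i // θ i ^ 2 ≠ 1}, Real.log (3 * logHeight₁ (θ k.val ^ 2)) +
        2 * (Fintype.card {i // θ i ^ 2 ≠ 1} : ℝ) := by
    have h1 : 0 ≤ ∑ k : {i // θ i ^ 2 ≠ 1}, Real.log (3 * logHeight₁ (θ k.val ^ 2)) := by
      apply Finset.sum_nonneg
      intro k _
      apply Real.log_nonneg
      have := log_two_le_logHeight₁ (hκ k).1 (hκ k).2.2.1 (hκ k).2.2.2.1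
      linarith [Real.log_two_gt_d9]
    have h2 : 0 ≤ Real.log B₀ := Real.log_nonneg (by linarith)
    positivity
  have hLT : 0 ≤ (2 * C / Real.log 2) ^ m * Θ' := by positivity
  have hkey : C ^ Fintype.card {i // θ i ^ 2 ≠ 1} * (p / Real.log p) *
      (∏ k : {i // θ i ^ 2 ≠ 1}, logHeight₁ (θ k.val ^ 2)) *
      (Real.log B₀ + Real.log p +
        ∑ k : {i // θ i ^ 2 ≠ 1}, Real.log (3 * logHeight₁ (θ k.val ^ 2)) +
          2 * (Fintype.card {i // θ i ^ 2 ≠ 1} : ℝ)) ≤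
      (p / Real.log p) * (((2 * C / Real.log 2) ^ m * Θ') * (16 ^ m * L)) := by
    have h := mul_le_mul hW hS hS0 hLT
    have h' := mul_le_mul_of_nonneg_left h hpdiv
    calc _ = (p / Real.log p) * ((C ^ Fintype.card {i // θ i ^ 2 ≠ 1} *
          ∏ k : {i // θ i ^ 2 ≠ 1}, logHeight₁ (θ k.val ^ 2)) *
          (Real.log B₀ + Real.log p +
            ∑ k : {i // θ i ^ 2 ≠ 1}, Real.log (3 * logHeight₁ (θ k.val ^ 2)) +
              2 * (Fintype.card {i // θ i ^ 2 ≠ 1} : ℝ))) := by ring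
      _ ≤ _ := h'
  have hconst : (p / Real.log p) * (((2 * C / Real.log 2) ^ m * Θ') * (16 ^ m * L)) =
      (32 * C / Real.log 2) ^ m * (p / Real.log p) * L * Θ' := by
    have : (32 * C / Real.log 2) ^ m = (2 * C / Real.log 2) ^ m * 16 ^ m := by
      rw [← mul_pow]; congr 1; ring
    rw [this]; ring
  linarith


end Literature.NumberTheory.DiophantineGeometry.Dioph

end
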